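/-
Copyright (c) 2026. All rights reserved.
Released under Apache 2.0 license as described in the file LICENSE.
-/
import Summits.KontsevichZagierPeriods.KontsevichZagierPeriods.Theorems.SoloInformedStuffleCut
import Summits.KontsevichZagierPeriods.KontsevichZagierPeriods.Theorems.SoloInformedShuffleChains

/-!
# PROGRAMME XLI, file 2 — the stuffle in `𝒫`: the cube representations, their moves and classes

With the cut products `X_K, Y_K, P` of `SoloInformedStuffleCut` (dimension `n+4`, cut
`1 ≤ K ≤ n+1`) this file builds the four cube representations

* `CubeZ c = [(0,1)ᶜ⁺², 1/(1 − P)]`                       — class `mzvClass [c+2]`,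
* `CutF K  = [(0,1)ⁿ⁺⁴, 1/((1 − X_K)(1 − Y_K))]`,
* `CutQ K  = [(0,1)ⁿ⁺⁴, X_K/((1 − X_K)(1 − P))]`         — class `mzvClass [K+1, n+3−K]`,
* `CutC K  = [(0,1)ⁿ⁺⁴, 1/((1 − Y_K)(1 − P))]`,

proves the rule-(1b) move `[CutF K] − [CutQ K] − [CutC K] ∈ relations` (the partial-fraction
identity `soloInformed_cut_partial_fraction`) and computes the two classes by rule (2) along the
prefix-product chart `κ` (`soloInformed_topWord_kappa`, `soloInformed_cutWord_kappa`).  Only the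
three naive Kontsevich–Zagier rules are used; integrability is domination by the half weight.
-/

noncomputable section

open MeasureTheory Set MvPolynomial
open Literature.ModelTheory.ExponentialFields Literature.NumberTheory.Transcendental
open Literature.NumberTheory.Transcendental.KZ

namespace Summit.KontsevichZagierPeriods.KontsevichZagierPeriods.Theorems

/-! ## 1. Continuity of the products -/

/-- Prefix products are continuous. -/
theorem soloInformed_continuous_prefixProd {k : ℕ} (j : Fin k) :
    Continuous fun x : Fin k → ℝ => soloInformedPrefixProd x j := by
  unfold soloInformedPrefixProd; fun_prop

/-- Suffix products are continuous. -/
theorem soloInformed_continuous_suffixProd {k : ℕ} (j : Fin k) :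
    Continuous fun x : Fin k → ℝ => soloInformedSuffixProd x j := by
  unfold soloInformedSuffixProd; fun_prop

/-! ## 2. The cube representation of `ζ(c+2)` -/

section cubeZ

variable (c : ℕ)

/-- `z(x) = 1/(1 − x₀⋯x_{c+1})`. -/
def soloInformedCubeZf (x : Fin (c + 2) → ℝ) : ℝ :=
  1 / (1 - soloInformedPrefixProd x (Fin.last (c + 1)))

/-- `z` is continuous on the open cube. -/
theorem soloInformed_continuousOn_cubeZf :
    ContinuousOn (soloInformedCubeZf c) (soloInformedOpenCube (c + 2)) :=
  ContinuousOn.div continuousOn_const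
    (continuous_const.sub (soloInformed_continuous_prefixProd _)).continuousOn
    fun _ hx => (soloInformed_one_sub_prefix_pos hx _).ne'

/-- `|z| ≤ W_{1/2}` on the open cube. -/
theorem soloInformed_cubeZf_le_W {x : Fin (c + 2) → ℝ} (hx : x ∈ soloInformedOpenCube (c + 2)) :
    |soloInformedCubeZf c x| ≤ 1 * soloInformedW (fun _ => 1 / 2) x := by
  unfold soloInformedCubeZf
  rw [abs_of_pos (one_div_pos.2 (soloInformed_one_sub_prefix_pos hx (Fin.last (c + 1)))), one_mul]
  exact soloInformed_top_le_W hx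

/-- **`CubeZ c = [(0,1)ᶜ⁺², 1/(1 − x₀⋯x_{c+1})]`**, the cube representation of `ζ(c+2)`
(expand the geometric series: `∫ ∑ₖ (x₀⋯x_{c+1})ᵏ = ∑ₖ (k+1)^{−(c+2)}`). -/
def soloInformedCubeZ : IntegralRep (c + 2) where
  domain := soloInformedOpenCube (c + 2)
  integrand := soloInformedCubeZf c
  isSemialgebraic_domain := isSemialgebraic_soloInformedOpenCube _
  isSemialgebraicFunOn_integrand :=
    soloInformed_isSemialgebraicFunOn_quot (isSemialgebraic_soloInformedOpenCube _) 1
      (1 - soloInformedMonoPoly (c + 2) (Fin.last (c + 1))) _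
      (fun x hx => by
        simpa [soloInformed_aeval_monoPoly] using
          (soloInformed_one_sub_prefix_pos hx (Fin.last (c + 1))).ne')
      fun x _ => by simp [soloInformedCubeZf, soloInformed_aeval_monoPoly]
  integrableOn := soloInformed_integrableOn_of_le_W (soloInformed_measurableSet_openCube _) subset_rfl
    (soloInformed_continuousOn_cubeZf c) (fun _ => 1 / 2) (fun _ => by norm_num) 1
    fun _ hx => soloInformed_cubeZf_le_W c hx

/-- The word of `[c+2]`: the single letter `ω₁` sits at the last slot. -/
theorem soloInformed_word_top (k : Fin (c + 2)) :
    (MZV.binaryWord [c + 2]).getD k false = decide (k = Fin.last (c + 1)) := by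
  simp only [soloInformed_binaryWord_single_getD, decide_eq_decide, Fin.ext_iff, Fin.val_last]
  omega

/-- **`⟦CubeZ c⟧ = mzvClass [c+2]`** (rule (2) along `κ`). -/
theorem soloInformed_cubeZ_class : toFormalPeriod (of (soloInformedCubeZ c)) = mzvClass [c + 2] := by
  obtain ⟨r, hd, hi, hcl⟩ := soloInformed_exists_wordRep (u := [c + 2]) (N := c + 2)
    ⟨by simp, fun _ => by simp⟩ (by simp [MZV.weight])
  rw [← hcl, toFormalPeriod_eq_iff]
  refine soloInformed_of_sub_of_mem_relations_polyMapCLM (soloInformedMonoPoly (c + 2)) _ r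
    (soloInformed_injOn_kappa (c + 2)) (by rw [hd]; exact (soloInformed_image_kappa_eq (c + 2)).symm)
    fun x hx => ?_
  rw [hi]
  simp only [soloInformed_word_top]
  exact soloInformed_topWord_kappa hx

end cubeZ

/-! ## 3. The three cut representations -/

section cut

variable {n : ℕ} (K : Fin (n + 4)) (hK : 1 ≤ K.1 ∧ K.1 ≤ n + 1)

/-- `F_K = 1/((1 − X_K)(1 − Y_K))`, the product integrand read through the cut `K`. -/
def soloInformedCutFf (x : Fin (n + 4) → ℝ) : ℝ :=
  1 / ((1 - soloInformedPrefixProd x K) * (1 - soloInformedSuffixProd x K))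

/-- `Q_K = X_K/((1 − X_K)(1 − P))`. -/
def soloInformedCutQf (x : Fin (n + 4) → ℝ) : ℝ :=
  soloInformedPrefixProd x K /
    ((1 - soloInformedPrefixProd x K) * (1 - soloInformedPrefixProd x (Fin.last (n + 3))))

/-- `C_K = 1/((1 − Y_K)(1 − P))`. -/
def soloInformedCutCf (x : Fin (n + 4) → ℝ) : ℝ :=
  1 / ((1 - soloInformedSuffixProd x K) * (1 - soloInformedPrefixProd x (Fin.last (n + 3))))

/-- `Q_K` is continuous on the open cube. -/
theorem soloInformed_continuousOn_cutQf :
    ContinuousOn (soloInformedCutQf K) (soloInformedOpenCube (n + 4)) :=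
  ContinuousOn.div (soloInformed_continuous_prefixProd K).continuousOn
    (((continuous_const.sub (soloInformed_continuous_prefixProd K)).mul
      (continuous_const.sub (soloInformed_continuous_prefixProd _))).continuousOn)
    fun _ hx => (mul_pos (soloInformed_one_sub_prefix_pos hx K)
      (soloInformed_one_sub_prefix_pos hx _)).ne'

include hK

/-- `C_K` is continuous on the open cube. -/
theorem soloInformed_continuousOn_cutCf :
    ContinuousOn (soloInformedCutCf K) (soloInformedOpenCube (n + 4)) :=
  ContinuousOn.div continuousOn_const
    (((continuous_const.sub (soloInformed_continuous_suffixProd K)).mul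
      (continuous_const.sub (soloInformed_continuous_prefixProd _))).continuousOn)
    fun _ hx => (mul_pos (soloInformed_one_sub_suffix_pos hK hx)
      (soloInformed_one_sub_prefix_pos hx _)).ne'

variable {K}

/-- `|Q_K| ≤ W_{1/2}`. -/
theorem soloInformed_cutQf_le_W {x : Fin (n + 4) → ℝ} (hx : x ∈ soloInformedOpenCube (n + 4)) :
    |soloInformedCutQf K x| ≤ 1 * soloInformedW (fun _ => 1 / 2) x := by
  unfold soloInformedCutQf
  rw [abs_of_pos (div_pos (soloInformed_prefixProd_pos hx K) (mul_pos
    (soloInformed_one_sub_prefix_pos hx K) (soloInformed_one_sub_prefix_pos hx (Fin.last (n + 3))))),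
    one_mul]
  exact soloInformed_cutQ1_le_W hK hx

/-- `|C_K| ≤ W_{1/2}`. -/
theorem soloInformed_cutCf_le_W {x : Fin (n + 4) → ℝ} (hx : x ∈ soloInformedOpenCube (n + 4)) :
    |soloInformedCutCf K x| ≤ 1 * soloInformedW (fun _ => 1 / 2) x := by
  unfold soloInformedCutCf
  rw [abs_of_pos (one_div_pos.2 (mul_pos (soloInformed_one_sub_suffix_pos hK hx)
    (soloInformed_one_sub_prefix_pos hx (Fin.last (n + 3))))), one_mul]
  exact soloInformed_cutC_le_W hK hx

variable (K)

/-- **`CutQ K = [(0,1)ⁿ⁺⁴, X_K/((1 − X_K)(1 − P))]`.** -/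
def soloInformedCutQ : IntegralRep (n + 4) where
  domain := soloInformedOpenCube (n + 4)
  integrand := soloInformedCutQf K
  isSemialgebraic_domain := isSemialgebraic_soloInformedOpenCube _
  isSemialgebraicFunOn_integrand :=
    soloInformed_isSemialgebraicFunOn_quot (isSemialgebraic_soloInformedOpenCube _)
      (soloInformedMonoPoly (n + 4) K)
      ((1 - soloInformedMonoPoly (n + 4) K) * (1 - soloInformedMonoPoly (n + 4) (Fin.last (n + 3)))) _
      (fun x hx => by
        simpa [soloInformed_aeval_monoPoly] using (mul_pos (soloInformed_one_sub_prefix_pos hx K)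
          (soloInformed_one_sub_prefix_pos hx (Fin.last (n + 3)))).ne')
      fun x _ => by simp [soloInformedCutQf, soloInformed_aeval_monoPoly]
  integrableOn := soloInformed_integrableOn_of_le_W (soloInformed_measurableSet_openCube _) subset_rfl
    (soloInformed_continuousOn_cutQf K) (fun _ => 1 / 2) (fun _ => by norm_num) 1
    fun _ hx => soloInformed_cutQf_le_W hK hx

/-- **`CutC K = [(0,1)ⁿ⁺⁴, 1/((1 − Y_K)(1 − P))]`.** -/
def soloInformedCutC : IntegralRep (n + 4) where
  domain := soloInformedOpenCube (n + 4)
  integrand := soloInformedCutCf K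
  isSemialgebraic_domain := isSemialgebraic_soloInformedOpenCube _
  isSemialgebraicFunOn_integrand :=
    soloInformed_isSemialgebraicFunOn_quot (isSemialgebraic_soloInformedOpenCube _) 1
      ((1 - soloInformedSuffixPoly (n + 4) K) * (1 - soloInformedMonoPoly (n + 4) (Fin.last (n + 3)))) _
      (fun x hx => by
        simpa [soloInformed_aeval_monoPoly] using (mul_pos (soloInformed_one_sub_suffix_pos hK hx)
          (soloInformed_one_sub_prefix_pos hx (Fin.last (n + 3)))).ne')
      fun x _ => by simp [soloInformedCutCf, soloInformed_aeval_monoPoly]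
  integrableOn := soloInformed_integrableOn_of_le_W (soloInformed_measurableSet_openCube _) subset_rfl
    (soloInformed_continuousOn_cutCf K hK) (fun _ => 1 / 2) (fun _ => by norm_num) 1
    fun _ hx => soloInformed_cutCf_le_W hK hx

/-! ## 4. The class of `CutQ K` -/

/-- The cut is not the last index. -/
theorem soloInformed_cut_ne_last : K ≠ Fin.last (n + 3) :=
  ne_of_apply_ne Fin.val (by rw [Fin.val_last]; omega)

/-- The word of `[K+1, n+3−K]`: letters `ω₁` at the slots `K` and `last`. -/
theorem soloInformed_word_cut (k : Fin (n + 4)) :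
    (MZV.binaryWord [K.1 + 1, n + 3 - K.1]).getD k false = decide (k = K ∨ k = Fin.last (n + 3)) := by
  rw [soloInformed_binaryWord_pair_getD _ _ _ (by omega) (by omega)]
  simp only [decide_eq_decide, Fin.ext_iff, Fin.val_last]
  omega

/-- **`⟦CutQ K⟧ = mzvClass [K+1, n+3−K]`** (rule (2) along `κ`). -/
theorem soloInformed_cutQ_class :
    toFormalPeriod (of (soloInformedCutQ K hK)) = mzvClass [K.1 + 1, n + 3 - K.1] := by
  obtain ⟨r, hd, hi, hcl⟩ := soloInformed_exists_wordRep (u := [K.1 + 1, n + 3 - K.1]) (N := n + 4)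
    ⟨fun i hi => by
        simp only [List.mem_cons, List.not_mem_nil, or_false] at hi
        omega,
      fun _ => by simp; omega⟩
    (by simp [MZV.weight]; omega)
  rw [← hcl, toFormalPeriod_eq_iff]
  refine soloInformed_of_sub_of_mem_relations_polyMapCLM (soloInformedMonoPoly (n + 4)) _ r
    (soloInformed_injOn_kappa (n + 4)) (by rw [hd]; exact (soloInformed_image_kappa_eq (n + 4)).symm)
    fun x hx => ?_
  rw [hi]
  have h := soloInformed_cutWord_kappa hx (K.castPred (soloInformed_cut_ne_last K hK))
  simp only [Fin.castSucc_castPred] at h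
  simp only [soloInformed_word_cut K hK]
  exact h

end cut

end Summit.KontsevichZagierPeriods.KontsevichZagierPeriods.Theorems
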